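import Mathlib
import HarnessLib

/-!
# Ignoring the singularity (Davis–Rabinowitz 1984, Sect. 2.12.7)

Davis–Rabinowitz, *Methods of Numerical Integration* (2nd ed., 1984), Sect. 2.12.7 "Ignoring the
Singularity": an integrand `f` on `[0, 1]` that is unbounded near `x = 1` may simply be fed to a sequence
of ordinary integration rules.  If `f` is majorised by a monotonic integrable function, the process
converges (Davis–Rabinowitz; Rabinowitz; Miller).

* The class `M` of functions `g ≥ 0`, continuous and nondecreasing on `[0, 1)` with
  `lim_{t → 1⁻} ∫_0^t g < ∞` (`ClassM`; for `g ≥ 0` the improper-integrability clause is recorded as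
  Lebesgue integrability on `[0, 1)`), and the class `BM` of functions `f` continuous on `[0, 1)` with
  `|f| ≤ g` there for some `g ∈ M` (`ClassBM`).
* (2.12.7.2)–(2.12.7.3) a sequence of rules `Q_n f = Σ_{k=1}^{m_n} w_{nk} f(x_{nk})` with abscissas
  `0 ≤ x_{n,m_n} ≤ … ≤ x_{n1} < x_{n0} = 1` (`ruleSeq`);
* (2.12.7.4) convergence for every `f ∈ C[0, 1]`;
* (2.12.7.5)–(2.12.7.6) the weight condition `|w_{nk}| ≤ c (x_{n,k-1} - x_{nk})` for all large `n` and all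
  `k` with `|x_{nk} - 1| < δ`;
* **Theorem (2.12.7.7)** (Rabinowitz): under these hypotheses `Q_n f → ∫_0^1 f` for every `f ∈ BM`
  (`tendsto_ruleSeq_of_classBM`).

The book indexes the `n`-th rule by exactly `n` points and orders the abscissas strictly; both are relaxed
here (any number `m_n` of points, weakly ordered abscissas), which only widens the statement.  The special
case of compound rules (Theorem (2.12.7.1)), the closed-rule variant (2.12.7.8) and the Gauss–Jacobi
statement (2.12.7.9) are not formalised in this file.
All statements are over `ℝ` with the Lebesgue / interval integral of Mathlib; no `sorry`, standard axioms.
-/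

noncomputable section

open Finset MeasureTheory intervalIntegral Set Filter Topology

namespace Literature.Analysis.Quadrature

/-- The class `M` of Sect. 2.12.7: `g ≥ 0`, continuous and nondecreasing on `[0, 1)`, and integrable on
`[0, 1)` (for a nonnegative nondecreasing `g` this is the book's `lim_{t → 1⁻} ∫_0^t g(x) dx < ∞`).
[cite: DavisRabinowitz1984, Sect. 2.12.7 (2.12.7.1)] -/
def ClassM (g : ℝ → ℝ) : Prop :=
  (∀ x ∈ Ico (0:ℝ) 1, 0 ≤ g x) ∧ ContinuousOn g (Ico 0 1) ∧ MonotoneOn g (Ico 0 1) ∧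
    IntegrableOn g (Ico 0 1)

/-- The class `BM` of Sect. 2.12.7: `f` continuous on `[0, 1)` and majorised there, `|f x| ≤ g x`, by some
`g ∈ M`. [cite: DavisRabinowitz1984, Sect. 2.12.7 (2.12.7.1)] -/
def ClassBM (f : ℝ → ℝ) : Prop :=
  ContinuousOn f (Ico 0 1) ∧ ∃ g, ClassM g ∧ ∀ x ∈ Ico (0:ℝ) 1, |f x| ≤ g x

/-- A sequence of rules (2.12.7.2): `Q_n f = Σ_{k=1}^{m_n} w_{nk} f(x_{nk})`.
[cite: DavisRabinowitz1984, Sect. 2.12.7 (2.12.7.2)] -/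
def ruleSeq (m : ℕ → ℕ) (w x : ℕ → ℕ → ℝ) (n : ℕ) (f : ℝ → ℝ) : ℝ :=
  ∑ k ∈ Finset.Icc 1 (m n), w n k * f (x n k)

/-- A function of class `M` is of class `BM` (it majorises itself).
[cite: DavisRabinowitz1984, Sect. 2.12.7 (2.12.7.1)] -/
theorem classBM_of_classM {g : ℝ → ℝ} (hg : ClassM g) : ClassBM g :=
  ⟨hg.2.1, g, hg, fun x hx => by rw [abs_of_nonneg (hg.1 x hx)]⟩

/-! ### Two folklore estimates for a nondecreasing majorant -/

/-- [folklore] Lower Riemann–Stieltjes step: for `g` nondecreasing on `[0, 1)` and `0 ≤ a ≤ b ≤ 1` with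
`a < 1`, `(b - a) g(a) ≤ ∫_{[a, b)} g`. -/
private theorem sub_mul_le_setIntegral_Ico {g : ℝ → ℝ} (hmono : MonotoneOn g (Ico 0 1))
    (hint : IntegrableOn g (Ico 0 1)) {a b : ℝ} (ha : 0 ≤ a) (hab : a ≤ b) (hb : b ≤ 1) (ha1 : a < 1) :
    (b - a) * g a ≤ ∫ t in Ico a b, g t := by
  have hsub : Ico a b ⊆ Ico 0 1 := fun t ht => ⟨ha.trans ht.1, ht.2.trans_le hb⟩
  have hint' : IntegrableOn g (Ico a b) := hint.mono_set hsub
  have hconst : ∫ _ in Ico a b, g a = (b - a) * g a := by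
    rw [setIntegral_const, smul_eq_mul, Real.volume_real_Ico_of_le hab]
  rw [← hconst]
  refine setIntegral_mono_on (integrableOn_const (by rw [Real.volume_Ico]; exact ENNReal.ofReal_ne_top))
    hint' measurableSet_Ico ?_
  intro t ht
  exact hmono ⟨ha, ha1⟩ (hsub ht) ht.1

/-- [folklore] Summing the steps over the abscissas beyond `1 - η` of a weakly decreasing chain
`x_M ≤ … ≤ x_1 ≤ x_0 = 1` in `[0, 1)`: `Σ (x_{k-1} - x_k) g(x_k) ≤ ∫_{[1-η, 1)} g` (the intervals
`[x_k, x_{k-1})` are pairwise disjoint and lie in `[1 - η, 1)`). -/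
private theorem sum_gap_mul_le_setIntegral {g : ℝ → ℝ} (hg0 : ∀ t ∈ Ico (0:ℝ) 1, 0 ≤ g t)
    (hmono : MonotoneOn g (Ico 0 1)) (hint : IntegrableOn g (Ico 0 1)) {x : ℕ → ℝ} {M : ℕ}
    (hx0 : x 0 = 1) (hx1 : ∀ k ∈ Finset.Icc 1 M, 0 ≤ x k ∧ x k < 1)
    (hanti : ∀ j k, j ≤ k → k ≤ M → x k ≤ x j) {η : ℝ} (hη1 : η ≤ 1) :
    ∑ k ∈ (Finset.Icc 1 M).filter (fun k => 1 - η < x k), (x (k - 1) - x k) * g (x k)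
      ≤ ∫ t in Ico (1 - η) 1, g t := by
  set S := (Finset.Icc 1 M).filter (fun k => 1 - η < x k) with hS
  have hmemS : ∀ k ∈ S, 1 ≤ k ∧ k ≤ M ∧ 1 - η < x k := fun k hk => by
    simp only [hS, Finset.mem_filter, Finset.mem_Icc] at hk
    exact ⟨hk.1.1, hk.1.2, hk.2⟩
  have hxle1 : ∀ k ∈ S, x (k - 1) ≤ 1 := fun k hk => by
    have h := hanti 0 (k - 1) (Nat.zero_le _) (by have := (hmemS k hk).2.1; omega)
    rwa [hx0] at h
  -- termwise lower Riemann–Stieltjes step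
  have hterm : ∀ k ∈ S, (x (k - 1) - x k) * g (x k) ≤ ∫ t in Ico (x k) (x (k - 1)), g t := by
    intro k hk
    obtain ⟨hk1, hkM, -⟩ := hmemS k hk
    obtain ⟨hxk0, hxk1⟩ := hx1 k (Finset.mem_Icc.2 ⟨hk1, hkM⟩)
    exact sub_mul_le_setIntegral_Ico hmono hint hxk0 (hanti (k - 1) k (Nat.sub_le k 1) hkM)
      (hxle1 k hk) hxk1
  -- the intervals are pairwise disjoint and contained in `[1 - η, 1)`
  have hdisj : Set.Pairwise (↑S : Set ℕ) (Function.onFun Disjoint fun k => Ico (x k) (x (k - 1))) := by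
    intro j hj k hk hjk
    rcases lt_or_gt_of_ne hjk with h | h
    · refine Set.disjoint_left.2 fun t htj htk => ?_
      have : x (k - 1) ≤ x j := hanti j (k - 1) (by omega) (by have := (hmemS k hk).2.1; omega)
      exact absurd (htk.2.trans_le this) (not_lt.2 htj.1)
    · refine Set.disjoint_left.2 fun t htj htk => ?_
      have : x (j - 1) ≤ x k := hanti k (j - 1) (by omega) (by have := (hmemS j hj).2.1; omega)
      exact absurd (htj.2.trans_le this) (not_lt.2 htk.1)
  have hsub : (⋃ k ∈ S, Ico (x k) (x (k - 1))) ⊆ Ico (1 - η) 1 := by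
    intro t ht
    simp only [Set.mem_iUnion, exists_prop] at ht
    obtain ⟨k, hk, htk⟩ := ht
    exact ⟨((hmemS k hk).2.2.trans_le htk.1).le, htk.2.trans_le (hxle1 k hk)⟩
  have hint' : IntegrableOn g (Ico (1 - η) 1) :=
    hint.mono_set fun t ht => ⟨by linarith [ht.1], ht.2⟩
  calc ∑ k ∈ S, (x (k - 1) - x k) * g (x k)
      ≤ ∑ k ∈ S, ∫ t in Ico (x k) (x (k - 1)), g t := Finset.sum_le_sum hterm
    _ = ∫ t in ⋃ k ∈ S, Ico (x k) (x (k - 1)), g t := by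
        rw [integral_biUnion_finset S (fun _ _ => measurableSet_Ico) hdisj
          (fun k hk => hint'.mono_set fun t ht => hsub (Set.mem_iUnion₂.2 ⟨k, hk, ht⟩))]
    _ ≤ ∫ t in Ico (1 - η) 1, g t := by
        refine setIntegral_mono_set hint' ?_ hsub.eventuallyLE
        exact (ae_restrict_iff' measurableSet_Ico).2 (Eventually.of_forall fun t ht =>
          hg0 t ⟨by linarith [ht.1], ht.2⟩)

/-- **Theorem (2.12.7.7)** (Rabinowitz).  Let `Q_n f = Σ_{k=1}^{m_n} w_{nk} f(x_{nk})` be a sequence of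
rules with abscissas `0 ≤ x_{nk} < 1 = x_{n0}`, weakly decreasing in `k` ((2.12.7.3)), convergent to
`∫_0^1 f` for every `f` continuous on `[0, 1]` ((2.12.7.4)), and such that for some `c`, `δ > 0`,
`|w_{nk}| ≤ c (x_{n,k-1} - x_{nk})` for all sufficiently large `n` and all `k` with `|x_{nk} - 1| < δ`
((2.12.7.5)–(2.12.7.6)).  Then `Q_n f → ∫_0^1 f` for every `f ∈ BM`.
[cite: DavisRabinowitz1984, Sect. 2.12.7 (2.12.7.7)] -/
theorem tendsto_ruleSeq_of_classBM {m : ℕ → ℕ} {w x : ℕ → ℕ → ℝ}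
    (hx0 : ∀ n, x n 0 = 1)
    (hx1 : ∀ n, ∀ k ∈ Finset.Icc 1 (m n), 0 ≤ x n k ∧ x n k < 1)
    (hanti : ∀ n j k, j ≤ k → k ≤ m n → x n k ≤ x n j)
    (hconv : ∀ f : ℝ → ℝ, ContinuousOn f (Icc 0 1) →
      Tendsto (fun n => ruleSeq m w x n f) atTop (𝓝 (∫ t in (0:ℝ)..1, f t)))
    {c δ : ℝ} (hδ : 0 < δ)
    (hw : ∀ᶠ n in atTop, ∀ k ∈ Finset.Icc 1 (m n), |x n k - 1| < δ →
      |w n k| ≤ c * (x n (k - 1) - x n k))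
    {f : ℝ → ℝ} (hf : ClassBM f) :
    Tendsto (fun n => ruleSeq m w x n f) atTop (𝓝 (∫ t in (0:ℝ)..1, f t)) := by
  obtain ⟨hfc, g, ⟨hg0, hgc, hgm, hgi⟩, hfg⟩ := hf
  -- integrability facts
  have hgi' : IntegrableOn g (Icc 0 1) := by rw [integrableOn_Icc_iff_integrableOn_Ico]; exact hgi
  have hfi_Ico : IntegrableOn f (Ico 0 1) := by
    refine Integrable.mono' hgi (hfc.aestronglyMeasurable measurableSet_Ico) ?_
    exact (ae_restrict_iff' measurableSet_Ico).2 (Eventually.of_forall fun t ht => by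
      simpa [Real.norm_eq_abs] using hfg t ht)
  have hfi : IntegrableOn f (Icc 0 1) := by rw [integrableOn_Icc_iff_integrableOn_Ico]; exact hfi_Ico
  have hfii : ∀ a b, a ∈ Icc (0:ℝ) 1 → b ∈ Icc (0:ℝ) 1 → IntervalIntegrable f volume a b :=
    fun a b ha hb => (hfi.mono_set (uIcc_subset_Icc ha hb)).intervalIntegrable
  have hgii : ∀ a b, a ∈ Icc (0:ℝ) 1 → b ∈ Icc (0:ℝ) 1 → IntervalIntegrable g volume a b :=
    fun a b ha hb => (hgi'.mono_set (uIcc_subset_Icc ha hb)).intervalIntegrable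
  -- the tail `T(s) = ∫_s^1 g` is continuous on `[0, 1]` and vanishes at `s = 1`
  have hTcont : ContinuousOn (fun s => ∫ t in s..1, g t) (Icc 0 1) := by
    have h := intervalIntegral.continuousOn_primitive_interval_left (μ := volume) (f := g)
      (a := (0:ℝ)) (b := 1) (by rwa [Set.uIcc_of_le zero_le_one])
    rwa [Set.uIcc_of_le zero_le_one] at h
  rw [Metric.tendsto_atTop]
  intro ε hε
  set C : ℝ := max c 0 with hC
  have hC0 : 0 ≤ C := le_max_right _ _
  set ε' : ℝ := ε / (2 * C + 4) with hε'
  have hε'0 : 0 < ε' := div_pos hε (by linarith)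
  -- choose `η ∈ (0, min δ 1]` with `∫_{1-η}^1 g < ε'`
  have h1mem : (1:ℝ) ∈ Icc (0:ℝ) 1 := ⟨zero_le_one, le_rfl⟩
  obtain ⟨ρ, hρ, hρT⟩ := (Metric.continuousWithinAt_iff.1 (hTcont 1 h1mem)) ε' hε'0
  set η : ℝ := min (ρ / 2) (min δ 1) with hη
  have hη0 : 0 < η := lt_min (by linarith) (lt_min hδ zero_lt_one)
  have hηρ : η < ρ := (min_le_left _ _).trans_lt (by linarith)
  have hηδ : η ≤ δ := (min_le_right _ _).trans (min_le_left _ _)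
  have hη1 : η ≤ 1 := (min_le_right _ _).trans (min_le_right _ _)
  have hmem : (1 - η) ∈ Icc (0:ℝ) 1 := ⟨by linarith, by linarith⟩
  have hmem' : (1 - η) ∈ Ico (0:ℝ) 1 := ⟨by linarith, by linarith⟩
  set T : ℝ := ∫ t in (1 - η)..1, g t with hT
  have hTlt : T < ε' := by
    have hd : dist (1 - η) (1:ℝ) < ρ := by
      rw [Real.dist_eq, show (1:ℝ) - η - 1 = -η by ring, abs_neg, abs_of_pos hη0]; exact hηρ
    have h := hρT hmem hd
    rw [intervalIntegral.integral_same, Real.dist_eq, sub_zero] at h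
    exact (le_abs_self _).trans_lt h
  have hTset : ∫ t in Ico (1 - η) 1, g t = T := by
    rw [hT, intervalIntegral.integral_of_le (by linarith), integral_Ico_eq_integral_Ioo,
      ← integral_Ioc_eq_integral_Ioo]
  have hT0 : 0 ≤ T := by
    rw [← hTset]
    exact setIntegral_nonneg measurableSet_Ico fun t ht => hg0 t ⟨by linarith [ht.1], ht.2⟩
  -- the truncated, continuous integrand `ft`
  set ft : ℝ → ℝ := fun s => f (min s (1 - η)) with hft
  have hmaps : MapsTo (fun s : ℝ => min s (1 - η)) (Icc 0 1) (Ico 0 1) := fun s hs =>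
    ⟨le_min hs.1 hmem.1, (min_le_right _ _).trans_lt hmem'.2⟩
  have hftc : ContinuousOn ft (Icc 0 1) :=
    hfc.comp (continuous_id.min continuous_const).continuousOn hmaps
  have hft_eq : ∀ s, s ≤ 1 - η → ft s = f s := fun s hs => by simp [hft, min_eq_left hs]
  have hft_bd : ∀ s ∈ Ico (0:ℝ) 1, 1 - η < s → |f s - ft s| ≤ 2 * g s := by
    intro s hs hlt
    have h1 : ft s = f (1 - η) := by simp [hft, min_eq_right hlt.le]
    rw [h1]
    calc |f s - f (1 - η)| ≤ |f s| + |f (1 - η)| := abs_sub _ _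
      _ ≤ g s + g (1 - η) := add_le_add (hfg s hs) (hfg _ hmem')
      _ ≤ g s + g s := by linarith [hgm hmem' hs hlt.le]
      _ = 2 * g s := by ring
  -- (i) the rules applied to `ft` converge
  have h2 : ∀ᶠ n in atTop, |ruleSeq m w x n ft - ∫ t in (0:ℝ)..1, ft t| < ε' := by
    have h := (hconv ft hftc)
    rw [Metric.tendsto_atTop] at h
    obtain ⟨N, hN⟩ := h ε' hε'0
    exact eventually_atTop.2 ⟨N, fun n hn => by simpa [Real.dist_eq] using hN n hn⟩
  -- (ii) the rules applied to `f - ft` are small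
  have h1 : ∀ᶠ n in atTop, |ruleSeq m w x n f - ruleSeq m w x n ft| ≤ 2 * C * T := by
    filter_upwards [hw] with n hn
    have hdiff : ruleSeq m w x n f - ruleSeq m w x n ft =
        ∑ k ∈ (Finset.Icc 1 (m n)).filter (fun k => 1 - η < x n k),
          w n k * (f (x n k) - ft (x n k)) := by
      rw [ruleSeq, ruleSeq, ← Finset.sum_sub_distrib, Finset.sum_filter]
      refine Finset.sum_congr rfl fun k hk => ?_
      split_ifs with h
      · ring
      · rw [hft_eq _ (not_lt.1 h)]; ring
    rw [hdiff]
    calc |∑ k ∈ (Finset.Icc 1 (m n)).filter (fun k => 1 - η < x n k),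
            w n k * (f (x n k) - ft (x n k))|
        ≤ ∑ k ∈ (Finset.Icc 1 (m n)).filter (fun k => 1 - η < x n k),
            |w n k * (f (x n k) - ft (x n k))| := Finset.abs_sum_le_sum_abs _ _
      _ ≤ ∑ k ∈ (Finset.Icc 1 (m n)).filter (fun k => 1 - η < x n k),
            2 * C * ((x n (k - 1) - x n k) * g (x n k)) := by
          refine Finset.sum_le_sum fun k hk => ?_
          simp only [Finset.mem_filter] at hk
          obtain ⟨hkI, hlt⟩ := hk
          obtain ⟨hxk0, hxk1⟩ := hx1 n k hkI
          have hxI : x n k ∈ Ico (0:ℝ) 1 := ⟨hxk0, hxk1⟩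
          have hgap : 0 ≤ x n (k - 1) - x n k :=
            sub_nonneg.2 (hanti n (k - 1) k (Nat.sub_le k 1) (Finset.mem_Icc.1 hkI).2)
          have hwk : |w n k| ≤ C * (x n (k - 1) - x n k) := by
            have h := hn k hkI (by rw [abs_sub_comm, abs_of_pos (by linarith)]; linarith)
            exact h.trans (mul_le_mul_of_nonneg_right (le_max_left _ _) hgap)
          rw [abs_mul]
          calc |w n k| * |f (x n k) - ft (x n k)|
              ≤ C * (x n (k - 1) - x n k) * (2 * g (x n k)) :=
                mul_le_mul hwk (hft_bd _ hxI hlt) (abs_nonneg _) (mul_nonneg hC0 hgap)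
            _ = 2 * C * ((x n (k - 1) - x n k) * g (x n k)) := by ring
      _ = 2 * C * ∑ k ∈ (Finset.Icc 1 (m n)).filter (fun k => 1 - η < x n k),
            (x n (k - 1) - x n k) * g (x n k) := by rw [Finset.mul_sum]
      _ ≤ 2 * C * T := by
          rw [← hTset]
          exact mul_le_mul_of_nonneg_left
            (sum_gap_mul_le_setIntegral hg0 hgm hgi (hx0 n) (hx1 n) (hanti n) hη1)
            (by positivity)
  -- (iii) the integrals of `f` and `ft` are close
  have h3 : |(∫ t in (0:ℝ)..1, f t) - ∫ t in (0:ℝ)..1, ft t| ≤ 2 * T := by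
    have hfti : ∀ a b, a ∈ Icc (0:ℝ) 1 → b ∈ Icc (0:ℝ) 1 → IntervalIntegrable ft volume a b :=
      fun a b ha hb => (hftc.mono (uIcc_subset_Icc ha hb)).intervalIntegrable
    have h0mem : (0:ℝ) ∈ Icc (0:ℝ) 1 := ⟨le_rfl, zero_le_one⟩
    have hsplit_f : ∫ t in (0:ℝ)..1, f t = (∫ t in (0:ℝ)..(1 - η), f t) + ∫ t in (1 - η)..1, f t :=
      (intervalIntegral.integral_add_adjacent_intervals (hfii _ _ h0mem hmem)
        (hfii _ _ hmem h1mem)).symm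
    have hsplit_ft : ∫ t in (0:ℝ)..1, ft t =
        (∫ t in (0:ℝ)..(1 - η), ft t) + ∫ t in (1 - η)..1, ft t :=
      (intervalIntegral.integral_add_adjacent_intervals (hfti _ _ h0mem hmem)
        (hfti _ _ hmem h1mem)).symm
    have hhead : ∫ t in (0:ℝ)..(1 - η), ft t = ∫ t in (0:ℝ)..(1 - η), f t :=
      intervalIntegral.integral_congr fun s hs => by
        rw [Set.uIcc_of_le hmem.1] at hs
        exact hft_eq s hs.2
    have htail : |(∫ t in (1 - η)..1, f t) - ∫ t in (1 - η)..1, ft t| ≤ 2 * T := by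
      rw [← intervalIntegral.integral_sub (hfii _ _ hmem h1mem) (hfti _ _ hmem h1mem), hT,
        ← intervalIntegral.integral_const_mul]
      have hae : ∀ᵐ t ∂volume, t ∈ Ioc (1 - η) 1 → ‖f t - ft t‖ ≤ 2 * g t := by
        filter_upwards [measure_eq_zero_iff_ae_notMem.1 (measure_singleton (1:ℝ))] with t ht hmem_t
        have ht1 : t < 1 := lt_of_le_of_ne hmem_t.2 ht
        rw [Real.norm_eq_abs]
        exact hft_bd t ⟨by linarith [hmem_t.1], ht1⟩ hmem_t.1
      have h := intervalIntegral.norm_integral_le_of_norm_le (by linarith) hae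
        ((hgii _ _ hmem h1mem).const_mul 2)
      rwa [Real.norm_eq_abs] at h
    rw [hsplit_f, hsplit_ft, hhead]
    have : (∫ t in (0:ℝ)..(1 - η), f t) + (∫ t in (1 - η)..1, f t) -
        ((∫ t in (0:ℝ)..(1 - η), f t) + ∫ t in (1 - η)..1, ft t) =
        (∫ t in (1 - η)..1, f t) - ∫ t in (1 - η)..1, ft t := by ring
    rw [this]; exact htail
  obtain ⟨N, hN⟩ := eventually_atTop.1 (h1.and h2)
  refine ⟨N, fun n hn => ?_⟩
  obtain ⟨hn1, hn2⟩ := hN n hn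
  rw [Real.dist_eq]
  have hCT : 2 * C * T ≤ 2 * C * ε' := mul_le_mul_of_nonneg_left hTlt.le (by positivity)
  have hkey : (2 * C + 4) * ε' = ε := by rw [hε']; field_simp
  have htri : |ruleSeq m w x n f - ∫ t in (0:ℝ)..1, f t|
      ≤ |ruleSeq m w x n f - ruleSeq m w x n ft| + |ruleSeq m w x n ft - ∫ t in (0:ℝ)..1, ft t|
        + |(∫ t in (0:ℝ)..1, ft t) - ∫ t in (0:ℝ)..1, f t| := by
    have := abs_sub_le (ruleSeq m w x n f) (ruleSeq m w x n ft) (∫ t in (0:ℝ)..1, f t)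
    have := abs_sub_le (ruleSeq m w x n ft) (∫ t in (0:ℝ)..1, ft t) (∫ t in (0:ℝ)..1, f t)
    linarith
  rw [abs_sub_comm (∫ t in (0:ℝ)..1, ft t)] at htri
  nlinarith [hT0, hC0, htri, hn1, hn2, h3, hCT, hkey, hTlt]

/-! ### The text's example of a `BM` function -/

/-- The majorant `g(x) = (1 - x)^{-1/2}` is of class `M`.
[cite: DavisRabinowitz1984, Sect. 2.12.7 (2.12.7.1)] -/
theorem classM_inv_sqrt_one_sub : ClassM fun x => (1 - x) ^ (-(1/2 : ℝ)) := by
  refine ⟨fun x hx => Real.rpow_nonneg (by linarith [hx.2]) _, ?_, ?_, ?_⟩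
  · exact ContinuousOn.rpow_const (continuousOn_const.sub continuousOn_id)
      fun x hx => Or.inl (by linarith [hx.2])
  · intro x hx y hy hxy
    exact Real.rpow_le_rpow_of_nonpos (by linarith [hy.2]) (by linarith) (by norm_num)
  · -- `∫_0^1 (1 - x)^{-1/2} dx` converges: exponent `> -1`
    have h : IntervalIntegrable (fun x => (1 - x) ^ (-(1/2 : ℝ))) volume 0 1 := by
      have h1 := (intervalIntegral.intervalIntegrable_rpow' (a := (1:ℝ) - 0) (b := 1 - 1)
        (r := -(1/2 : ℝ)) (by norm_num)).comp_sub_left 1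
      simpa using h1
    rw [intervalIntegrable_iff_integrableOn_Icc_of_le zero_le_one] at h
    exact h.mono_set Ico_subset_Icc_self

/-- The text's example: `f(x) = (1 - x)^{-1/2} sin (1 - x)^{-1/2}` is of class `BM` (majorant
`(1 - x)^{-1/2}`); the book adds that it is not of class `M` (not monotonic), which is not formalised.
[cite: DavisRabinowitz1984, Sect. 2.12.7 (2.12.7.1)] -/
theorem classBM_inv_sqrt_mul_sin :
    ClassBM fun x => (1 - x) ^ (-(1/2 : ℝ)) * Real.sin ((1 - x) ^ (-(1/2 : ℝ))) := by
  have hc : ContinuousOn (fun x : ℝ => (1 - x) ^ (-(1/2 : ℝ))) (Ico 0 1) :=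
    classM_inv_sqrt_one_sub.2.1
  refine ⟨hc.mul (Real.continuous_sin.comp_continuousOn hc), _, classM_inv_sqrt_one_sub, ?_⟩
  intro x hx
  rw [abs_mul, abs_of_nonneg (Real.rpow_nonneg (by linarith [hx.2]) _)]
  exact mul_le_of_le_one_right (Real.rpow_nonneg (by linarith [hx.2]) _) (Real.abs_sin_le_one _)

end Literature.Analysis.Quadrature

end
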